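import Summits.QuantumFields.YangMills.Theorems.PencilRigidityHypercubicLimitDefs
import HarnessLib

/-!
# Crux `HypercubicLimit` (stmt-QuantumFields-16154), line `peel-and-disseminate` (c1 seat): the host closure at weak coupling

Support file (`--supports stmt-QuantumFields-16154`, registered sub-goal `oneFieldLimitWeak_of_legs`).  The line
`peel-and-disseminate` (skeleton `Cruxes/HypercubicLimit/Lines/peel_and_disseminate.lean`) consumes the closure of its host
line `conditional-mean-telescoping` (vocabulary `Theorems/PencilRigidityHypercubicLimitDefs.lean`: (L′) `LatticeGapInput`,
(S) `SoftLegs`, (R) `ReflectionLegs`, reassembled there as `oneFieldLimit_of_legs : … → OneFieldLimit`) but needs the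
one-field clauses AT WEAK COUPLING, i.e. with the extra conjunct `sch.HasWeakCouplingLimit` of the re-typed crux
stmt-QuantumFields-16154 (right-hand side of `OneFieldWeak.hypercubicLimit_iff_oneFieldWeak`).  Nothing new is needed: the
host's `SoftData` already records `Tendsto sch.β atTop atTop`, which IS `SpeciesScheme.HasWeakCouplingLimit`.  Pure logic.
Refs: JaffeWitten2000 §6 (continuum limit at the Gaussian UV fixed point); card `Cruxes/HypercubicLimit/Ideas/peel-and-disseminate.md`.
-/

set_option autoImplicit false

noncomputable section

open scoped SchwartzMap
open MeasureTheory Filter Topology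
open Literature.MathematicalPhysics.AQFT Literature.MathematicalPhysics.QuantumLattice
open Literature.MathematicalPhysics.QuantumFieldTheory
open Summit.QuantumFields.YangMills.Cruxes.HypercubicLimit.ConditionalMeanTelescoping
  (LatticeGapInput SoftLegs ReflectionLegs)

namespace Summit.QuantumFields.YangMills.Cruxes.HypercubicLimit.PeelAndDisseminate

/-- **The host closure reassembled at weak coupling** (registered sub-goal `oneFieldLimitWeak_of_legs` of crux
stmt-QuantumFields-16154, line `peel-and-disseminate`): (L′) supplies `r` and the gap data, (R) the torus demand `Λ`, (S) the
scheme, the one-field family and the soft clauses for that demand; `SoftData`'s second conjunct `Tendsto sch.β atTop atTop` is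
`sch.HasWeakCouplingLimit`, and `SoftClauses ∧ ReflClauses` are the one-field clauses with `Δ = 1`.  Stated for every Borel
structure on `G` (the crux's `letI := borel G` instance is a special case). [folklore] -/
theorem oneFieldLimitWeak_of_legs : LatticeGapInput → SoftLegs → ReflectionLegs →
    ∀ (G : Type) [Group G] [TopologicalSpace G] [IsTopologicalGroup G] [CompactSpace G] [MeasurableSpace G]
      [BorelSpace G], IsCompactSimpleLieGroup G →
        ∃ (r : LatticeRep G) (sch : SpeciesScheme (YMSpecies G)) (S₁ : SchwingerFamily (EuclideanSpace ℝ (Fin 4))),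
          sch.HasWeakCouplingLimit ∧ ((S₁.toLabelled.IsNormalized ∧ S₁.toLabelled.IsHermitian ∧
            S₁.toLabelled.HasLinearGrowth ∧
          S₁.toLabelled.IsReflectionPositive ∧ S₁.toLabelled.IsSymmetric ∧ S₁.toLabelled.HasClusterProperty ∧
          (∀ (n : ℕ) (k : Fin n → Unit) (a : EuclideanSpace ℝ (Fin 4)) (F : 𝓢((Fin n → EuclideanSpace ℝ (Fin 4)), ℂ)),
            IsOffDiagonal F → S₁.toLabelled n k (translateMulti a F) = S₁.toLabelled n k F) ∧
          (∀ (n : ℕ) (k : Fin n → Unit) (R : EuclideanSpace ℝ (Fin 4) ≃ₗᵢ[ℝ] EuclideanSpace ℝ (Fin 4)),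
            LinearMap.det (R.toLinearEquiv : EuclideanSpace ℝ (Fin 4) →ₗ[ℝ] EuclideanSpace ℝ (Fin 4)) = 1 →
            (∀ i : Fin 4, ∃ j : Fin 4, R (EuclideanSpace.single i 1) = EuclideanSpace.single j 1 ∨
              R (EuclideanSpace.single i 1) = -EuclideanSpace.single j 1) →
            ∀ F : 𝓢((Fin n → EuclideanSpace ℝ (Fin 4)), ℂ), IsOffDiagonal F →
              S₁.toLabelled n k (linActMulti R F) = S₁.toLabelled n k F)) ∧
        (∀ (n : ℕ), n ≠ 0 → ∀ (f : Fin n → 𝓢(EuclideanSpace ℝ (Fin 4), ℝ))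
            (F : 𝓢((Fin n → EuclideanSpace ℝ (Fin 4)), ℂ)),
          IsTensorOf F (fun i => ofRealTest (f i)) → IsOffDiagonal F →
            Tendsto (fun k : ℕ =>
              ((latticeSchwinger r.ρ sch (fun s => s.F) k n (fun _ => r.curvature) f : ℝ) : ℂ))
              atTop (𝓝 (S₁ n F))) ∧
        (∃ (F₁ G₁ : 𝓢((Fin 1 → EuclideanSpace ℝ (Fin 4)), ℂ)) (H₁ : 𝓢((Fin (1 + 1) → EuclideanSpace ℝ (Fin 4)), ℂ)),
          IsTimeOrdered F₁ ∧ IsTimeOrdered G₁ ∧ IsAppendTensorOf H₁ (osAdjoint F₁) G₁ ∧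
            S₁.toLabelled (1 + 1) (fun _ => ()) H₁ ≠
              S₁.toLabelled 1 (fun _ => ()) (osAdjoint F₁) * S₁.toLabelled 1 (fun _ => ()) G₁) ∧
        (∃ (f g h : 𝓢(EuclideanSpace ℝ (Fin 4), ℂ)) (Ffgh : 𝓢((Fin 3 → EuclideanSpace ℝ (Fin 4)), ℂ))
            (Fgh Ffh Ffg : 𝓢((Fin 2 → EuclideanSpace ℝ (Fin 4)), ℂ))
            (Ff Fg Fh : 𝓢((Fin 1 → EuclideanSpace ℝ (Fin 4)), ℂ)),
          IsTensorOf Ffgh ![f, g, h] ∧ IsOffDiagonal Ffgh ∧ IsTensorOf Fgh ![g, h] ∧ IsTensorOf Ffh ![f, h] ∧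
          IsTensorOf Ffg ![f, g] ∧ IsTensorOf Ff ![f] ∧ IsTensorOf Fg ![g] ∧ IsTensorOf Fh ![h] ∧
            S₁.toLabelled 3 (fun _ => ()) Ffgh - S₁.toLabelled 1 (fun _ => ()) Ff * S₁.toLabelled 2 (fun _ => ()) Fgh -
              S₁.toLabelled 1 (fun _ => ()) Fg * S₁.toLabelled 2 (fun _ => ()) Ffh -
              S₁.toLabelled 1 (fun _ => ()) Fh * S₁.toLabelled 2 (fun _ => ()) Ffg +
              2 * (S₁.toLabelled 1 (fun _ => ()) Ff * S₁.toLabelled 1 (fun _ => ()) Fg *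
                S₁.toLabelled 1 (fun _ => ()) Fh) ≠ 0) ∧
        (∃ Δ : ℝ, 0 < Δ ∧ S₁.toLabelled.HasMassGap Δ ∧ HasLatticeMassGap r sch Δ)) := by
  intro hL hS hR G _ _ _ _ _ _ hG
  obtain ⟨r, β₁, C₁, c₂, m, hgap⟩ := hL G hG
  obtain ⟨Λ, hΛ⟩ := hR G hG r β₁ C₁ c₂ m hgap
  obtain ⟨δ₀, sch, S₁, Spl, hδ₀, hD, hE0, hE0', hE3, htr, hconv, hNT, hNG, hlat⟩ := hS G hG r β₁ C₁ c₂ m hgap Λ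
  obtain ⟨hherm, hRP, hcl, hhyp, hgap1⟩ := hΛ δ₀ sch S₁ Spl hδ₀ hD
  exact ⟨r, sch, S₁, hD.2.1, ⟨hE0, hherm, hE0', hRP, hE3, hcl, htr, hhyp⟩, hconv, by simpa using hNT,
    by simpa using hNG, 1, one_pos, hgap1, hlat⟩

end Summit.QuantumFields.YangMills.Cruxes.HypercubicLimit.PeelAndDisseminate

end
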